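import Summits.QuantumFields.YangMills.Theorems.IR.ColdDefectFiniteAbelian
import HarnessLib

/-!
# THE NUMBER's currency at a finite gauge group: the RATE of freezing and an explicit impurity threshold (helper for stmt-QuantumFields-26930)

Quantitative sequel of `ColdDefectFreezingLimit` (p783777), `FlatConnectionCount` (p784178) and `ColdDefectFiniteAbelian` (p784277); LEAD
prover `ymfull-r2c-lead-1` g0, cell `ym-gapexp`, `--supports stmt-QuantumFields-26930`.  For a FINITE gauge group every non-flat field pays at
least the action gap `Δ` (`Δ ≤ n − Re tr ρ(g)` for `g ≠ 1`), so the freezing of the partition function is exponentially fast and UNIFORM in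
nothing but the box:

* `measureReal_flat_le_wilsonFinTorusPartition`, `wilsonFinTorusPartition_le` — **`Haar(Flat) ≤ Z_β ≤ Haar(Flat) + e^{−βΔ}`** (`β ≥ 0`);
* `coldDefect_ge_of_gap` — hence `coldDefect ρ β L ≥ 1 − (Haar(Flat₂) + e^{−βΔ}) / Haar(Flat₁)²` at every `β ≥ 0`;
* `one_div_24_lt_coldDefect_of_exp_le` / `one_div_24_lt_coldDefect_of_le` — for a finite ABELIAN nontrivial `G` and `L ≥ 4`, with `V = L³⌊L/4⌋`:
  **if `|G|^{6V} e^{−βΔ} ≤ 1/2` — in particular if `β ≥ (6V·log|G| + log 2)/Δ` — then `coldDefect ρ β L > 1/24`** (indeed `≥ 1 − 1/8 − 1/128`).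

READING (the typed obstruction between fixed-box negatives and the stub).  The impurity threshold grows like the VOLUME, `β ≳ V log|G| / Δ`:
freezing controls a box only while `V e^{−βΔ} ≪ 1`, i.e. `L⁴ ≲ e^{βΔ}`.  The registered stub `stub_pinnedExitsCofinal` pins its box at
`L ≤ T/a(β)` with `a(β) → 0` arbitrary (slowly), so boxes `L ~ T/a(β)` eventually leave every freezing window unless `a(β) ≥ e^{−βΔ/4}`-ish — and
conversely a floor-free, binder-free PXcof-shape IS refuted at finite abelian `G` for units decaying slower than `e^{−βΔ/4}` (not landed: that
shape is already dead at SU(2), p624174).  Volume-uniform impurity at fixed `β` (the E-type ∕ cofinal shapes) would need a weak-coupling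
expansion of the finite-group theory in infinite volume (deconfined flux sectors), which is not attempted here.
HONEST FRAMING: finite-volume calibration on the BC5 side; nothing here proves `PinnedExitsCofinalAt`, `IRcof`, `IR`, or the Yang–Mills
mass gap.  Def-free.  References: 't Hooft 1979 (flux sectors); tree `Cao2020.actionGap` (the action gap `Δ_G` of a finite gauge group,
Cao 2020 §1.2) — here `Δ` is any explicit lower bound, taken as a hypothesis.
-/

set_option autoImplicit false

noncomputable section

open Filter Topology MeasureTheory
open Literature.MathematicalPhysics.QuantumFieldTheory Literature.MathematicalPhysics.QuantumLattice
open Summit.QuantumFields.YangMills.Cruxes.IR.ColdPurityBridge (coldDefect)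

namespace Summit.QuantumFields.YangMills.Cruxes.IR.FreezingLimit

section Finite

variable {G : Type} [Group G] [Fintype G] [TopologicalSpace G] [DiscreteTopology G] [IsTopologicalGroup G]
  [CompactSpace G] [MeasurableSpace G] [BorelSpace G]
variable {n : ℕ} (ρ : G →* Matrix (Fin n) (Fin n) ℂ) {Δ : ℝ} (hΔ : ∀ g : G, g ≠ 1 → Δ ≤ (n : ℝ) - (ρ g).trace.re)
include hΔ

omit [Fintype G] [MeasurableSpace G] [BorelSpace G] in
/-- **Action gap off the flat set.**  A field with some plaquette of non-maximal character has total Wilson action `≥ Δ`. -/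
theorem gap_le_action_of_not_flat {n₀ n₁ n₂ n₃ : ℕ} (U : FinTorusSite n₀ n₁ n₂ n₃ × Fin 4 → G)
    (hU : U ∉ {U : FinTorusSite n₀ n₁ n₂ n₃ × Fin 4 → G |
      ∀ (x : FinTorusSite n₀ n₁ n₂ n₃) (q : {q : Fin 4 × Fin 4 // q.1 < q.2}),
        (ρ (finTorusPlaquette U x q.1.1 q.1.2)).trace.re = n}) :
    Δ ≤ ∑ x : FinTorusSite n₀ n₁ n₂ n₃, ∑ q : {q : Fin 4 × Fin 4 // q.1 < q.2},
      ((n : ℝ) - (ρ (finTorusPlaquette U x q.1.1 q.1.2)).trace.re) := by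
  have hρc : Continuous ρ := continuous_of_discreteTopology
  simp only [Set.mem_setOf_eq, not_forall] at hU
  obtain ⟨x₀, q₀, hne⟩ := hU
  have hg : finTorusPlaquette U x₀ q₀.1.1 q₀.1.2 ≠ 1 := by
    intro h; apply hne; rw [h, map_one, Matrix.trace_one, Fintype.card_fin]; simp
  calc Δ ≤ (n : ℝ) - (ρ (finTorusPlaquette U x₀ q₀.1.1 q₀.1.2)).trace.re := hΔ _ hg
    _ ≤ ∑ q : {q : Fin 4 × Fin 4 // q.1 < q.2}, ((n : ℝ) - (ρ (finTorusPlaquette U x₀ q.1.1 q.1.2)).trace.re) :=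
        Finset.single_le_sum (f := fun q : {q : Fin 4 × Fin 4 // q.1 < q.2} =>
          (n : ℝ) - (ρ (finTorusPlaquette U x₀ q.1.1 q.1.2)).trace.re)
          (fun q _ => sub_re_trace_nonneg ρ hρc _) (Finset.mem_univ q₀)
    _ ≤ ∑ x : FinTorusSite n₀ n₁ n₂ n₃, ∑ q : {q : Fin 4 × Fin 4 // q.1 < q.2},
          ((n : ℝ) - (ρ (finTorusPlaquette U x q.1.1 q.1.2)).trace.re) :=
        Finset.single_le_sum (f := fun x : FinTorusSite n₀ n₁ n₂ n₃ => ∑ q : {q : Fin 4 × Fin 4 // q.1 < q.2},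
          ((n : ℝ) - (ρ (finTorusPlaquette U x q.1.1 q.1.2)).trace.re))
          (fun x _ => Finset.sum_nonneg fun q _ => sub_re_trace_nonneg ρ hρc _) (Finset.mem_univ x₀)

/-- **Lower freezing bound**: `Haar(Flat) ≤ Z_β` (`β ≥ 0`; the weight is `1` on the flat set and `≥ 0` elsewhere). -/
theorem measureReal_flat_le_wilsonFinTorusPartition {β : ℝ} (hβ : 0 ≤ β) (n₀ n₁ n₂ n₃ : ℕ) :
    (Measure.pi fun _ : FinTorusSite n₀ n₁ n₂ n₃ × Fin 4 => haarProbability G).real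
        {U : FinTorusSite n₀ n₁ n₂ n₃ × Fin 4 → G |
          ∀ (x : FinTorusSite n₀ n₁ n₂ n₃) (q : {q : Fin 4 × Fin 4 // q.1 < q.2}),
            (ρ (finTorusPlaquette U x q.1.1 q.1.2)).trace.re = n} ≤
      wilsonFinTorusPartition ρ β n₀ n₁ n₂ n₃ := by
  have hρc : Continuous ρ := continuous_of_discreteTopology
  have _ := hΔ
  rw [← integral_indicator_one (measurableSet_flat ρ hρc n₀ n₁ n₂ n₃)]
  unfold wilsonFinTorusPartition
  refine integral_mono ((integrable_const 1).indicator (measurableSet_flat ρ hρc n₀ n₁ n₂ n₃))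
    ((integrable_const 1).mono' (continuous_weight ρ hρc β n₀ n₁ n₂ n₃).aestronglyMeasurable
      (Eventually.of_forall fun U => by
        rw [Real.norm_of_nonneg (Real.exp_nonneg _)]; exact weight_le_one ρ hρc hβ U)) fun U => ?_
  by_cases hU : U ∈ {U : FinTorusSite n₀ n₁ n₂ n₃ × Fin 4 → G |
      ∀ (x : FinTorusSite n₀ n₁ n₂ n₃) (q : {q : Fin 4 × Fin 4 // q.1 < q.2}),
        (ρ (finTorusPlaquette U x q.1.1 q.1.2)).trace.re = n}
  · rw [Set.indicator_of_mem hU, Pi.one_apply, (action_eq_zero_iff ρ hρc U).2 hU, mul_zero, Real.exp_zero]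
  · rw [Set.indicator_of_notMem hU]
    exact Real.exp_nonneg _

/-- **Upper freezing bound (the rate)**: `Z_β ≤ Haar(Flat) + e^{−βΔ}` for `β ≥ 0` — off the flat set the weight is `≤ e^{−βΔ}`. -/
theorem wilsonFinTorusPartition_le {β : ℝ} (hβ : 0 ≤ β) (n₀ n₁ n₂ n₃ : ℕ) :
    wilsonFinTorusPartition ρ β n₀ n₁ n₂ n₃ ≤
      (Measure.pi fun _ : FinTorusSite n₀ n₁ n₂ n₃ × Fin 4 => haarProbability G).real
        {U : FinTorusSite n₀ n₁ n₂ n₃ × Fin 4 → G |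
          ∀ (x : FinTorusSite n₀ n₁ n₂ n₃) (q : {q : Fin 4 × Fin 4 // q.1 < q.2}),
            (ρ (finTorusPlaquette U x q.1.1 q.1.2)).trace.re = n} + Real.exp (-(β * Δ)) := by
  have hρc : Continuous ρ := continuous_of_discreteTopology
  set π : Measure (FinTorusSite n₀ n₁ n₂ n₃ × Fin 4 → G) :=
    Measure.pi fun _ : FinTorusSite n₀ n₁ n₂ n₃ × Fin 4 => haarProbability G with hπ
  set Fl := {U : FinTorusSite n₀ n₁ n₂ n₃ × Fin 4 → G |
      ∀ (x : FinTorusSite n₀ n₁ n₂ n₃) (q : {q : Fin 4 × Fin 4 // q.1 < q.2}),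
        (ρ (finTorusPlaquette U x q.1.1 q.1.2)).trace.re = n} with hFl
  have hmeas : MeasurableSet Fl := measurableSet_flat ρ hρc n₀ n₁ n₂ n₃
  -- pointwise: weight ≤ 1_Flat + e^{-βΔ}
  have hpt : ∀ U, Real.exp (-β * ∑ x : FinTorusSite n₀ n₁ n₂ n₃, ∑ q : {q : Fin 4 × Fin 4 // q.1 < q.2},
        ((n : ℝ) - (ρ (finTorusPlaquette U x q.1.1 q.1.2)).trace.re)) ≤ Fl.indicator 1 U + Real.exp (-(β * Δ)) := by
    intro U
    by_cases hU : U ∈ Fl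
    · rw [Set.indicator_of_mem hU, Pi.one_apply]
      linarith [weight_le_one ρ hρc hβ U, Real.exp_nonneg (-(β * Δ))]
    · rw [Set.indicator_of_notMem hU, zero_add]
      refine Real.exp_le_exp.2 ?_
      rw [neg_mul, neg_le_neg_iff]
      exact mul_le_mul_of_nonneg_left (gap_le_action_of_not_flat ρ hΔ U hU) hβ
  have hint : ∫ U, (Fl.indicator 1 U + Real.exp (-(β * Δ))) ∂π = π.real Fl + Real.exp (-(β * Δ)) := by
    rw [integral_add ((integrable_const 1).indicator hmeas) (integrable_const _), integral_indicator_one hmeas,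
      integral_const, smul_eq_mul, probReal_univ, one_mul]
  unfold wilsonFinTorusPartition
  rw [← hint]
  exact integral_mono ((integrable_const 1).mono' (continuous_weight ρ hρc β n₀ n₁ n₂ n₃).aestronglyMeasurable
      (Eventually.of_forall fun U => by rw [Real.norm_of_nonneg (Real.exp_nonneg _)]; exact weight_le_one ρ hρc hβ U))
    (((integrable_const 1).indicator hmeas).add (integrable_const _)) hpt

/-- **The cold purity defect at finite `β`, finite gauge group**: `coldDefect ρ β L ≥ 1 − (Haar(Flat₂) + e^{−βΔ}) / Haar(Flat₁)²` (`β ≥ 0`). -/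
theorem coldDefect_ge_of_gap {β : ℝ} (hβ : 0 ≤ β) (L : ℕ) :
    1 - ((Measure.pi fun _ : FinTorusSite L L L (2 * (L / 4)) × Fin 4 => haarProbability G).real
          {U : FinTorusSite L L L (2 * (L / 4)) × Fin 4 → G |
            ∀ (x : FinTorusSite L L L (2 * (L / 4))) (q : {q : Fin 4 × Fin 4 // q.1 < q.2}),
              (ρ (finTorusPlaquette U x q.1.1 q.1.2)).trace.re = n} + Real.exp (-(β * Δ))) /
        (Measure.pi fun _ : FinTorusSite L L L (L / 4) × Fin 4 => haarProbability G).real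
          {U : FinTorusSite L L L (L / 4) × Fin 4 → G |
            ∀ (x : FinTorusSite L L L (L / 4)) (q : {q : Fin 4 × Fin 4 // q.1 < q.2}),
              (ρ (finTorusPlaquette U x q.1.1 q.1.2)).trace.re = n} ^ 2 ≤
      coldDefect ρ β L := by
  unfold coldDefect
  have hP1 := measureReal_flat_pos (n₀ := L) (n₁ := L) (n₂ := L) (n₃ := L / 4) ρ
  have hZ1 := measureReal_flat_le_wilsonFinTorusPartition ρ hΔ hβ L L L (L / 4)
  have hZ2 := wilsonFinTorusPartition_le ρ hΔ hβ L L L (2 * (L / 4))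
  have hZ2pos : 0 ≤ wilsonFinTorusPartition ρ β L L L (2 * (L / 4)) :=
    (wilsonFinTorusPartition_pos continuous_of_discreteTopology β L L L (2 * (L / 4))).le
  have hsq : (Measure.pi fun _ : FinTorusSite L L L (L / 4) × Fin 4 => haarProbability G).real
          {U : FinTorusSite L L L (L / 4) × Fin 4 → G |
            ∀ (x : FinTorusSite L L L (L / 4)) (q : {q : Fin 4 × Fin 4 // q.1 < q.2}),
              (ρ (finTorusPlaquette U x q.1.1 q.1.2)).trace.re = n} ^ 2 ≤
      wilsonFinTorusPartition ρ β L L L (L / 4) ^ 2 := pow_le_pow_left₀ hP1.le hZ1 2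
  have := div_le_div₀ (by linarith [Real.exp_nonneg (-(β * Δ))]) hZ2 (pow_pos hP1 2) hsq
  linarith

end Finite

/-! ## The explicit impurity threshold at a finite abelian gauge group -/

section FiniteAbelian

variable {G : Type} [CommGroup G] [Fintype G] [TopologicalSpace G] [DiscreteTopology G] [IsTopologicalGroup G]
  [CompactSpace G] [MeasurableSpace G] [BorelSpace G]
variable {n : ℕ} (ρ : G →* Matrix (Fin n) (Fin n) ℂ) {Δ : ℝ} (hΔ0 : 0 < Δ) (hΔ : ∀ g : G, g ≠ 1 → Δ ≤ (n : ℝ) - (ρ g).trace.re)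
include hΔ0 hΔ

omit [Fintype G] [TopologicalSpace G] [DiscreteTopology G] [IsTopologicalGroup G] [CompactSpace G] [MeasurableSpace G]
  [BorelSpace G] in
/-- A positive action gap makes the character detect the identity. -/
theorem re_trace_eq_iff_of_gap (g : G) : (ρ g).trace.re = n ↔ g = 1 := by
  constructor
  · intro h
    by_contra hg
    have := hΔ g hg
    rw [h, sub_self] at this
    exact absurd this (not_le.2 hΔ0)
  · rintro rfl
    rw [map_one, Matrix.trace_one, Fintype.card_fin]; simp

/-- **Explicit impurity**: for a finite abelian NONTRIVIAL gauge group, `L ≥ 4`, `V = L³⌊L/4⌋` and `β ≥ 0` with `|G|^{6V} e^{−βΔ} ≤ 1/2`,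
THE NUMBER's cold box is not `1/24`-pure: `1/24 < coldDefect ρ β L` (indeed `coldDefect ≥ 1 − 1/8 − 1/128`). -/
theorem one_div_24_lt_coldDefect_of_exp_le [Nontrivial G] {L : ℕ} (hL : 4 ≤ L) {β : ℝ} (hβ : 0 ≤ β)
    (hsmall : (Fintype.card G : ℝ) ^ (6 * (L * (L * (L * (L / 4))))) * Real.exp (-(β * Δ)) ≤ 1 / 2) :
    (1 : ℝ) / 24 < coldDefect ρ β L := by
  have hρ := re_trace_eq_iff_of_gap ρ hΔ0 hΔ
  have hL0 : 0 < L := by omega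
  have hT : 0 < L / 4 := Nat.div_pos hL (by norm_num)
  have hT2 : 0 < 2 * (L / 4) := by omega
  have hge := coldDefect_ge_of_gap ρ hΔ hβ L
  rw [measureReal_charFlat ρ hρ hL0 hL0 hL0 hT2, measureReal_charFlat ρ hρ hL0 hL0 hL0 hT] at hge
  simp only [Fintype.card_prod, Fintype.card_fin] at hge
  have hV : L * (L * (L * (2 * (L / 4)))) = 2 * (L * (L * (L * (L / 4)))) := by ring
  rw [hV] at hge
  set V : ℕ := L * (L * (L * (L / 4))) with hVdef
  have h2 : (2 : ℝ) ≤ Fintype.card G := by exact_mod_cast Fintype.one_lt_card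
  set q : ℝ := (Fintype.card G : ℝ) with hqdef
  have hq : 0 < q := by linarith
  set ε : ℝ := Real.exp (-(β * Δ)) with hε
  have hε0 : 0 ≤ ε := Real.exp_nonneg _
  -- the bound of `coldDefect_ge_of_gap` in closed form: 1 - q⁻³ - ε q^{8V} / q^{2V+6}
  have hclosed : 1 - (q ^ (2 * V + 3) / q ^ (2 * V * 4) + ε) / (q ^ (V + 3) / q ^ (V * 4)) ^ 2 =
      1 - (q ^ 3)⁻¹ - ε * q ^ (6 * V) / q ^ 6 := by
    field_simp
    ring
  rw [hclosed] at hge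
  -- numerics: q⁻³ ≤ 1/8 and ε q^{6V} / q^6 ≤ (1/2)/64
  have h8 : (8 : ℝ) ≤ q ^ 3 := by
    have := pow_le_pow_left₀ (by norm_num) h2 3; norm_num at this; exact this
  have h64 : (64 : ℝ) ≤ q ^ 6 := by
    have := pow_le_pow_left₀ (by norm_num) h2 6; norm_num at this; exact this
  have hA : (q ^ 3)⁻¹ ≤ 1 / 8 := by rw [one_div]; exact inv_anti₀ (by norm_num) h8
  have hB : ε * q ^ (6 * V) / q ^ 6 ≤ (1 / 2) / 64 := by
    rw [mul_comm] at hsmall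
    exact div_le_div₀ (by norm_num) hsmall (by norm_num) h64
  linarith

/-- **Explicit `β`-threshold**: for a finite abelian nontrivial gauge group, `L ≥ 4`, `V = L³⌊L/4⌋`, and
`β ≥ (6V·log|G| + log 2)/Δ`, THE NUMBER's cold box `L³ × ⌊L/4⌋` is not `1/24`-pure.  The threshold grows like the volume. -/
theorem one_div_24_lt_coldDefect_of_le [Nontrivial G] {L : ℕ} (hL : 4 ≤ L) {β : ℝ}
    (hβ : (((6 * (L * (L * (L * (L / 4))))) : ℕ) * Real.log (Fintype.card G) + Real.log 2) / Δ ≤ β) :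
    (1 : ℝ) / 24 < coldDefect ρ β L := by
  have h2 : (2 : ℝ) ≤ Fintype.card G := by exact_mod_cast Fintype.one_lt_card
  have hqpos : (0 : ℝ) < Fintype.card G := by linarith
  have hlogq : 0 ≤ Real.log (Fintype.card G : ℝ) := Real.log_nonneg (by linarith)
  have hlog2 : 0 < Real.log 2 := Real.log_pos (by norm_num)
  have hnum : 0 ≤ (((6 * (L * (L * (L * (L / 4))))) : ℕ) : ℝ) * Real.log (Fintype.card G) + Real.log 2 := by positivity
  have hβ0 : 0 ≤ β := le_trans (div_nonneg hnum hΔ0.le) hβ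
  refine one_div_24_lt_coldDefect_of_exp_le ρ hΔ0 hΔ hL hβ0 ?_
  -- |G|^{6V} e^{-βΔ} ≤ 1/2  ⟸  βΔ ≥ 6V log|G| + log 2
  have hβΔ : (((6 * (L * (L * (L * (L / 4))))) : ℕ) : ℝ) * Real.log (Fintype.card G) + Real.log 2 ≤ β * Δ := by
    have := (div_le_iff₀ hΔ0).1 hβ
    linarith
  have hpow : (Fintype.card G : ℝ) ^ (6 * (L * (L * (L * (L / 4))))) =
      Real.exp ((((6 * (L * (L * (L * (L / 4))))) : ℕ) : ℝ) * Real.log (Fintype.card G)) := by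
    rw [Real.exp_nat_mul, Real.exp_log hqpos]
  rw [hpow, ← Real.exp_add]
  have hhalf : Real.exp (-Real.log 2) = 1 / 2 := by
    rw [Real.exp_neg, Real.exp_log (by norm_num : (0 : ℝ) < 2), one_div]
  rw [← hhalf]
  exact Real.exp_le_exp.2 (by linarith)

end FiniteAbelian

end Summit.QuantumFields.YangMills.Cruxes.IR.FreezingLimit

end
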